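import Summits.BirchSwinnertonDyer.BirchSwinnertonDyer.Theorems.PrintCf2SplitBadTwoKummerLocalPinning
import Summits.BirchSwinnertonDyer.BirchSwinnertonDyer.Theorems.PrintCf2SplitBadTwoKummerBridgePinning
import Summits.BirchSwinnertonDyer.BirchSwinnertonDyer.Theorems.PrintCf2SplitBadTwoF3CountsOfPlainRoad
import HarnessLib

/-!
# Crux `PrintCf2.SplitBadTwoRankOneOfFacts` (stmt-BirchSwinnertonDyer-20368), road α v10.3, S3c input (F3) — (PIN) DISCHARGED:
# `hPIN_holds` on every S3c frame, hence `hcounts ⟸ (PI) ∧ (ShaFin)`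

Cell `bsd-print-cf2`, EXTRA WIDTH seat `bsd-line-cf2-p1-w8` g3 (prover-bsd-line-cf2-p1-w8-g3-0); `--supports stmt-BirchSwinnertonDyer-20368`
(helper, Theses-free). HONEST FRAMING: nothing here closes the crux or a registered stub; BSD is not proved by any of this; no summit
statement is proved by this seat. No definition, no named fact, no `sorry`, no kit. beyond-print theorem: no.

WHAT. The displayed hypothesis `hPIN` ((a) ∧ (b)) of p680684 `hcounts_of_pointIndex_of_pinning_of_finiteSha` holds on every S3c frame:
* §1 `exists_toGeomPoints_eq_of_restrictField_fixed_of_frame` — DESCENT: a `Γ_{K_v}`-invariant of `W* = E[𝔮_r^∞]` is a `K`-rational point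
  (it is `D_v`-fixed, `#W*^{D_v} = 2` by -w2 g9 `natCard_fixedPoints_decomp_v_eq_two_of_frame`, so it is `2`-torsion, and `Γ_K` acts on `W*[2]`
  by scalars — -w2 `CMPrimes.endEigenPrimaryTorsion_two_structure` — hence trivially; Galois descent `exists_toGeomPoints_eq_of_forall_smul_eq`;
  the argument of -w3 g10 `exists_two_torsion_baseChange_eq_of_eigen_of_frame`, for points of `W*` instead of points of `E(K_v)`);
  `exists_density_at_v_of_frame` — DENSITY of `ℤ·P` in `E(K_v) ⊇ ℤ₂` (p677570 `exists_pow_nsmul_eq_zsmul_add`, -w7 g3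
  `exists_finiteIndex_addEquiv_padicInt_of_finrank_eq_one`, `K_v = ℚ₂` as `v ≠ v̄`).
* §2 **`hPIN_holds`** — (a) from p682371 `exists_map_levelProj_eq_localization_kummerMapTorsion` fed with the density, the level shadow at
  level `N + c` (-w6 `LevelEigen.exists_levelProj`) and (PIN)(b) at level `N + c` (p681392 `hPINb_holds`, read in `K_v` through -w5 g3
  `resOfLe_levelLift_eq_zero_iff`); (b) is p681392 `hPINb_holds`.
* §3 **`hcounts_of_pointIndex_of_finiteSha (hPI) (hShaFin) : hcounts`** — the displayed hypothesis `hcounts` of -w5 g3 p678471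
  `hF3_of_levelCounts` (⟹ hF3 ⟹ S3c with the LEAD's cut 15) from the TWO remaining displayed inputs: (PI) the local point index
  `v₂ [E(K_v) : im E(K) + 2^N E(K_v)] = ℓ + e₃(…)` and (ShaFin) `Ш(E/K)[2^∞]` finite.
presearch: Rubin LNM 1716 §2–§3 (Lemma 3.6 (ii)), Greenberg LNM 1716 §5 — tree theorems; no new fact. playbook: none fit.

References: [GreenbergLNM1716] §5 proof of Prop. 5.8; [Rubin1999] §2, §3 Lemma 3.6 (ii); [Agboola2007] §6, Prop. 8.1; [SilvermanAEC2009] VII.6.3,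
VIII §2, X §4; [MilneADT2006] I §6.
-/

noncomputable section

open scoped Classical

set_option linter.dupNamespace false
set_option autoImplicit false

open CategoryTheory Function Field NumberField IsDedekindDomain WeierstrassCurve
open Literature.NumberTheory.EllipticCurves Literature.NumberTheory.EllipticCurves.GreenbergSelmer
open Literature.NumberTheory.EllipticCurves.Agboola2007
open Literature.NumberTheory.GaloisRepresentations
open Literature.NumberTheory.GaloisRepresentations.DiscreteGaloisModule (SelmerStructure)
open Literature.NumberTheory.GaloisCohomology
open scoped ContRepresentation
open Summit.BirchSwinnertonDyer.Rank1Residual.X11b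
open Summit.BirchSwinnertonDyer.Rank1Residual.X11b.LocBridge
open Summit.BirchSwinnertonDyer.Rank1Residual.X11b.Levels
open Summit.BirchSwinnertonDyer.BirchSwinnertonDyer.Theorems.PrintCf2
open Summit.BirchSwinnertonDyer.BirchSwinnertonDyer.Theorems.PrintCf2.RestrictedSelmerPair
open Summit.BirchSwinnertonDyer.BirchSwinnertonDyer.Theorems.PrintCf2.LevelEigen
open Summit.BirchSwinnertonDyer.BirchSwinnertonDyer.Theorems.PrintCf2.AdditiveAtSeven
open Summit.BirchSwinnertonDyer.BirchSwinnertonDyer.Theorems.PrintCf2.LocalPointsScalar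
open Summit.BirchSwinnertonDyer.BirchSwinnertonDyer.Theorems.PrintCf2.CMPrimes
open Literature.NumberTheory.GaloisRepresentations (LocalField.adicCompletionPadicAlgebra)

namespace Summit.BirchSwinnertonDyer.BirchSwinnertonDyer.Theorems.PrintCf2.SelmerLocImage

/-! ## §1. Frame inputs: descent of `W*^{Γ_{K_v}}`, density of `ℤ·P` in `E(K_v)` -/

section Frame

variable {K : Type} [Field K] [NumberField K]

/-- **DESCENT of `W*^{Γ_{K_v}}` on an S3c frame**: a point of `W* = E[𝔮_r^∞]` fixed by `Γ_{K_v}` (acting through `Γ_{K_v} → D_v ≤ Γ_K`) is the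
image of a `K`-rational point — it is `D_v`-fixed, `#W*^{D_v} = 2` (-w2 g9), so `2x = 0`, and `Γ_K` acts on `W*[2]` by scalars, hence trivially.
[cite: Rubin1999, §2, §3 Lemma 3.6 (ii)] [cite: Agboola2007, §6 and Prop. 8.1] -/
theorem exists_toGeomPoints_eq_of_restrictField_fixed_of_frame {d : ℤ} (hd0 : d ≠ 0) (hsq : Squarefree d) (hd4 : d % 4 ≠ 1)
    (W : WeierstrassCurve ℚ) [W.IsElliptic] (C : VariableChange ℚ) (hC : C • W = cm7.quadraticTwist (d : ℚ)) (hK : IsImaginaryQuadratic K)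
    (v vbar : HeightOneSpectrum (𝓞 K)) (hv : ((2 : ℕ) : 𝓞 K) ∈ v.asIdeal) (hvbar : ((2 : ℕ) : 𝓞 K) ∈ vbar.asIdeal) (hne : vbar ≠ v)
    (π : (W.baseChange K).endRing) (hrel : (π : AddMonoid.End (W.baseChange K).geomPoints) * π = π - 2) {r : ℤ_[2]} (hr : r * r = r - 2)
    (hpin : ∀ τ ∈ GreenbergSelmer.inertia v, ∀ x : ↥((W.baseChange K).endEigenPrimaryTorsion 2 π r), τ • x = x ∨ τ • x = -x)
    (x : ↥((W.baseChange K).endEigenPrimaryTorsion 2 π r))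
    (hx : ∀ σ : absoluteGaloisGroup (v.adicCompletion K),
      GaloisRep.restrictField (v.adicCompletion K) (primaryGaloisModule (W.baseChange K) 2) σ
        (x : (W.baseChange K).geomPrimaryTorsion 2) = x) :
    ∃ T : (W.baseChange K).toAffine.Point,
      (((x : (W.baseChange K).geomPrimaryTorsion 2)) : (W.baseChange K).geomPoints) = toGeomPoints (W.baseChange K) T := by
  haveI : Fact (Nat.Prime 2) := ⟨Nat.prime_two⟩
  set m : (W.baseChange K).geomPrimaryTorsion 2 := (x : (W.baseChange K).geomPrimaryTorsion 2) with hm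
  -- `x` is `D_v`-fixed
  have hxfix : x ∈ FixedPoints.addSubgroup (decomp v) ↥((W.baseChange K).endEigenPrimaryTorsion 2 π r) := by
    rw [FixedPoints.mem_addSubgroup]
    intro δ
    obtain ⟨τ, hτ⟩ := (mem_decomp_iff v (δ : absoluteGaloisGroup K)).mp δ.2
    apply Subtype.ext
    change (δ : absoluteGaloisGroup K) • m = m
    rw [← hτ]
    exact hx τ
  -- `#W*^{D_v} = 2`, so `2 x = 0`
  have hcard := natCard_fixedPoints_decomp_v_eq_two_of_frame hd0 hsq hd4 W C hC hK v vbar hv hvbar hne π hrel hr hpin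
  haveI : Finite (FixedPoints.addSubgroup (decomp v) ↥((W.baseChange K).endEigenPrimaryTorsion 2 π r)) :=
    Nat.finite_of_card_ne_zero (by rw [hcard]; norm_num)
  have h2w : 2 • (⟨x, hxfix⟩ : FixedPoints.addSubgroup (decomp v) ↥((W.baseChange K).endEigenPrimaryTorsion 2 π r)) = 0 := by
    have h := card_nsmul_eq_zero'
      (x := (⟨x, hxfix⟩ : FixedPoints.addSubgroup (decomp v) ↥((W.baseChange K).endEigenPrimaryTorsion 2 π r)))
    rwa [hcard] at h
  have h2x : 2 • x = 0 := by
    have h := congrArg Subtype.val h2w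
    rw [AddSubmonoidClass.coe_nsmul, ZeroMemClass.coe_zero] at h
    exact h
  have h2m : 2 • m = 0 := by
    have h := congrArg Subtype.val h2x
    rw [AddSubmonoidClass.coe_nsmul, ZeroMemClass.coe_zero] at h
    exact h
  -- `Γ_K` acts on `W*[2]` by scalars, hence trivially
  have hj : W.j = -3375 := j_eq_of_smul_eq_cm7Twist hd0 W C hC
  obtain ⟨θ, hθ⟩ := exists_sq_eq_neg_seven_of_cmEndo_mem_endRing W K hj π hrel
  obtain ⟨-, -, -, -, -, -, -, hscal⟩ := endEigenPrimaryTorsion_two_structure W hj K hθ π hrel hr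
  have hyfix : ∀ σ : absoluteGaloisGroup K, σ • (m : (W.baseChange K).geomPoints) = m := by
    intro σ
    obtain ⟨N, hN⟩ := hscal σ 1
    have hσm : σ • m = N • m := hN m x.2 (by rw [pow_one]; exact h2m)
    have hσm' : σ • m = m := by
      obtain ⟨c, hc | hc⟩ := Int.even_or_odd' N
      · have h0 : σ • m = 0 := by
          rw [hσm, hc, mul_comm, mul_zsmul, two_zsmul, ← two_nsmul, h2m, zsmul_zero]
        have hm0 : m = 0 := by
          have := congrArg (fun z ↦ σ⁻¹ • z) h0
          simpa only [inv_smul_smul, smul_zero] using this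
        rw [hm0, smul_zero]
      · rw [hσm, hc, add_zsmul, one_zsmul, mul_comm, mul_zsmul, two_zsmul, ← two_nsmul, h2m, zsmul_zero, zero_add]
    have h1 := congrArg Subtype.val hσm'
    rw [primaryComponent.coe_smul] at h1
    exact h1
  obtain ⟨T, hT⟩ := exists_toGeomPoints_eq_of_forall_smul_eq (W := W.baseChange K) hyfix
  exact ⟨T, hT.symm⟩

/-- **DENSITY of the Mordell–Weil line at `v`** on an S3c frame: `E(K_v) ⊇ ℤ₂` of finite index (`K_v = ℚ₂` since `v ≠ v̄` above `2`; Silverman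
VII.6.3, -w7 g3) and `P` is non-torsion, so there is `c` with `2^c y ∈ ℤ·P_v + 2^N E(K_v)` for every `y ∈ E(K_v)` and every `N` (p677570
`exists_pow_nsmul_eq_zsmul_add`). [cite: SilvermanAEC2009, VII.6.3] -/
theorem exists_density_at_v_of_frame (W : WeierstrassCurve ℚ) [W.IsElliptic] (hK : IsImaginaryQuadratic K)
    (v vbar : HeightOneSpectrum (𝓞 K)) (hv : ((2 : ℕ) : 𝓞 K) ∈ v.asIdeal) (hvbar : ((2 : ℕ) : 𝓞 K) ∈ vbar.asIdeal) (hne : vbar ≠ v)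
    (P : W.toAffine.Point) (hP : ¬ IsOfFinAddOrder P) :
    ∃ c : ℕ, ∀ (N : ℕ) (y : ((W.baseChange K).baseChange (v.adicCompletion K)).toAffine.Point),
      ∃ (M : ℤ) (y' : ((W.baseChange K).baseChange (v.adicCompletion K)).toAffine.Point),
        2 ^ c • y = M • Affine.Point.baseChange (W' := W.baseChange K) K (v.adicCompletion K)
          (Affine.Point.baseChange (W' := W) ℚ K P) + 2 ^ N • y' := by
  haveI : Fact (Nat.Prime 2) := ⟨Nat.prime_two⟩
  have hPK : ¬ IsOfFinAddOrder (Affine.Point.baseChange (W' := W) ℚ K P) := fun h ↦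
    hP ((Affine.Point.map_injective (W' := W) (Algebra.ofId ℚ K)).isOfFinAddOrder_iff.mp h)
  letI : Algebra ℚ_[2] (v.adicCompletion K) := LocalField.adicCompletionPadicAlgebra v 2 hv
  have h1 : Module.finrank ℚ_[2] (v.adicCompletion K) = 1 := by
    rw [Literature.NumberTheory.NumberFields.finrank_adicCompletionPadicAlgebra_eq 2 v hv]
    exact ramificationIdx_mul_inertiaDeg_eq_one_of_ne hK.1 hv hvbar hne
  haveI : FiniteDimensional ℚ_[2] (v.adicCompletion K) := Module.finite_of_finrank_pos (by rw [h1]; exact one_pos)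
  obtain ⟨U, hU, ⟨eU⟩⟩ := exists_finiteIndex_addEquiv_padicInt_of_finrank_eq_one 2 h1 ((W.baseChange K).baseChange (v.adicCompletion K))
  haveI := hU
  have hPv : ¬ IsOfFinAddOrder (Affine.Point.baseChange (W' := W.baseChange K) K (v.adicCompletion K)
      (Affine.Point.baseChange (W' := W) ℚ K P)) := fun h ↦
    hPK ((Affine.Point.map_injective (W' := W.baseChange K) (Algebra.ofId K (v.adicCompletion K))).isOfFinAddOrder_iff.mp h)
  exact exists_pow_nsmul_eq_zsmul_add U eU hPv

end Frame

/-! ## §2. (PIN) holds on every S3c frame -/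

/-- **(PIN) DISCHARGED.** The displayed hypothesis `hPIN` of p680684 `hcounts_of_pointIndex_of_pinning_of_finiteSha`, VERBATIM, on every S3c
frame: (a) the `ẽ_N`-component of every local Kummer class at `v` is `loc_v κ_N(T)` for a rational torsion point `T` (p682371
`exists_map_levelProj_eq_localization_kummerMapTorsion` with §1's density and descent, the level shadow at level `N + c` of -w6
`LevelEigen.exists_levelProj`, and (PIN)(b) at level `N + c` read in `K_v` by -w5 g3 `resOfLe_levelLift_eq_zero_iff`); (b) the `D_v`-restrictions
of the lifted classes of the multiples of `P` vanish (p681392 `hPINb_holds`). [cite: GreenbergLNM1716, §5 proof of Prop. 5.8]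
[cite: Rubin1999, §2, §3 Lemma 3.6 (ii)] [cite: SilvermanAEC2009, X §4 diagram (**)] -/
theorem hPIN_holds :
    ∀ (d : ℤ), d ≠ 0 → Squarefree d → d % 4 ≠ 1 →
      ∀ (W : WeierstrassCurve ℚ) [W.IsElliptic] [W.IsGloballyMinimal] (C : WeierstrassCurve.VariableChange ℚ),
        C • W = cm7.quadraticTwist (d : ℚ) → W.analyticRank = 1 →
      ∀ (K : Type) [Field K] [NumberField K], IsImaginaryQuadratic K →
      ∀ (v vbar : HeightOneSpectrum (𝓞 K)),
        ((2 : ℕ) : 𝓞 K) ∈ v.asIdeal → ((2 : ℕ) : 𝓞 K) ∈ vbar.asIdeal → vbar ≠ v →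
      ∀ (π : (W.baseChange K).endRing), (π : AddMonoid.End (W.baseChange K).geomPoints) * π = π - 2 →
      ∀ (r : ℤ_[2]), r * r = r - 2 →
        (∀ τ ∈ GreenbergSelmer.inertia v, ∀ x : ↥((W.baseChange K).endEigenPrimaryTorsion 2 π r), τ • x = x ∨ τ • x = -x) →
      ∀ (P : W.toAffine.Point) (c₀ : ℕ) (ℓ : ℤ),
        ¬ IsOfFinAddOrder P →
        (∀ R : W.toAffine.Point, ∃ (k : ℤ) (T : W.toAffine.Point), IsOfFinAddOrder T ∧ R = k • P + T) →
        c₀ ≠ 0 → (W.baseChange ℚ_[2]).IsInReductionKernel (c₀ • W.toPadicPoint 2 P) →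
        ‖(W.baseChange ℚ_[2]).padicLogPoint (c₀ • W.toPadicPoint 2 P) / (c₀ : ℚ_[2])‖ = (2 : ℝ) ^ (-ℓ) →
      Finite (restrictedSelmerBase ↥((W.baseChange K).endEigenPrimaryTorsion 2 π r) 2 vbar) →
      ∀ (e : (W.baseChange K).geomPrimaryTorsion 2 →+ ↥((W.baseChange K).endEigenPrimaryTorsion 2 π r))
        (he₁ : ∀ x : ↥((W.baseChange K).endEigenPrimaryTorsion 2 π r), e x = x)
        (he0 : ∀ x ∈ (W.baseChange K).endEigenPrimaryTorsion 2 π (1 - r), e x = 0)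
        (he : ∀ (σ : absoluteGaloisGroup K) (x : (W.baseChange K).geomPrimaryTorsion 2), e (σ • x) = σ • e x)
        (N : ℕ) (eN : ((W.baseChange K).torsionGaloisModule ((2 ^ N : ℕ) : ℤ)).toContRepresentation →ⁱL
            ((W.baseChange K).torsionGaloisModule ((2 ^ N : ℕ) : ℤ)).toContRepresentation),
        (∀ y, primaryInclusion (W.baseChange K) 2 N (eN y) =
            (e (primaryInclusion (W.baseChange K) 2 N y) : (W.baseChange K).geomPrimaryTorsion 2)) →
        (∀ c ∈ (W.baseChange K).kummerSelmerStructure ((2 ^ N : ℕ) : ℤ) (Sum.inr v), ∃ T : (W.baseChange K).toAffine.Point,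
            IsOfFinAddOrder T ∧
            galoisCohomology.map (eN.restrictField (Place.Completion (Sum.inr v : Place K))) 1 c =
              galoisCohomology.localization ((W.baseChange K).torsionGaloisModule ((2 ^ N : ℕ) : ℤ)) (Sum.inr v) 1
                (kummerMapTorsion (W.baseChange K) ((2 ^ N : ℕ) : ℤ) ((W.baseChange K).zsmul_geomPoints_surjective_holds (NeZero.ne _)) T)) ∧
        (∀ M : ℤ, resOfLe ↥((W.baseChange K).endEigenPrimaryTorsion 2 π r) (inf_le_left : (⊤ : Subgroup (absoluteGaloisGroup K)) ⊓ decomp v ≤ ⊤)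
            (resH1Hom (Literature.NumberTheory.EllipticCurves.subgroupIncl (⊤ : Subgroup (absoluteGaloisGroup K)))
              (AddMonoidHom.id ↥((W.baseChange K).endEigenPrimaryTorsion 2 π r)) (fun _ _ ↦ rfl)
              (resH1Hom (ContinuousMonoidHom.id (absoluteGaloisGroup K)) e (fun σ m ↦ he σ m)
                (toDiscreteH1 (isOpen_stabilizer_geomPrimaryTorsion (W.baseChange K) 2)
                  (galoisCohomology.map (primaryInclusion (W.baseChange K) 2 N) 1
                    (kummerMapTorsion (W.baseChange K) ((2 ^ N : ℕ) : ℤ) ((W.baseChange K).zsmul_geomPoints_surjective_holds (NeZero.ne _))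
                      (M • Affine.Point.baseChange (W' := W) ℚ K P)))))) = 0) := by
  intro d hd0 hsq hd4 W _ _ C hC hrk K _ _ hK v vbar hv hvbar hne π hrel r hr hpinI P c₀ ℓ hP hgen hc₀ hker hlog hfin e he₁ he0 he N eN heN
  haveI : Fact (Nat.Prime 2) := ⟨Nat.prime_two⟩
  refine ⟨fun c hc ↦ ?_, fun M ↦ hPINb_holds d hd0 hsq hd4 W C hC hrk K hK v vbar hv hvbar hne π hrel r hr hpinI P c₀ ℓ hP hgen hc₀
    hker hlog hfin e he₁ he0 he N _⟩
  -- density at `v`, the shadow at level `N + cv`, the pinning there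
  obtain ⟨cv, hcv⟩ := exists_density_at_v_of_frame W hK v vbar hv hvbar hne P hP
  obtain ⟨eNc, -, heNc, -⟩ := exists_levelProj (W.baseChange K) 2 π r (N + cv) e he₁ he
  have hN : ((2 ^ N : ℕ) : ℤ) ≠ 0 := by exact_mod_cast pow_ne_zero N two_ne_zero
  have hNc : ((2 ^ (N + cv) : ℕ) : ℤ) ≠ 0 := by exact_mod_cast pow_ne_zero (N + cv) two_ne_zero
  have hpinb : ∀ M : ℤ, galoisCohomology.map ((primaryInclusion (W.baseChange K) 2 (N + cv)).restrictField (v.adicCompletion K)) 1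
      (galoisCohomology.map (eNc.restrictField (v.adicCompletion K)) 1
        (galoisCohomology.localization ((W.baseChange K).torsionGaloisModule ((2 ^ (N + cv) : ℕ) : ℤ)) (Sum.inr v) 1
          (kummerMapTorsion (W.baseChange K) ((2 ^ (N + cv) : ℕ) : ℤ) ((W.baseChange K).zsmul_geomPoints_surjective_holds (NeZero.ne _))
            (M • Affine.Point.baseChange (W' := W) ℚ K P)))) = 0 := fun M ↦
    (resOfLe_levelLift_eq_zero_iff (W.baseChange K) 2 π r (N + cv) e he he₁ eNc heNc v _).mp
      (hPINb_holds d hd0 hsq hd4 W C hC hrk K hK v vbar hv hvbar hne π hrel r hr hpinI P c₀ ℓ hP hgen hc₀ hker hlog hfin e he₁ he0 he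
        (N + cv) _)
  exact exists_map_levelProj_eq_localization_kummerMapTorsion (W.baseChange K) 2 π r N cv e he₁ he eN heN eNc heNc v hN hNc _ _
    (Affine.Point.baseChange (W' := W) ℚ K P) (fun y ↦ hcv (N + cv) y) hpinb
    (fun x hx ↦ exists_toGeomPoints_eq_of_restrictField_fixed_of_frame hd0 hsq hd4 W C hC hK v vbar hv hvbar hne π hrel hr hpinI x hx) c hc

/-! ## §3. `hcounts ⟸ (PI) ∧ (ShaFin)` -/

/-- **`hcounts` FROM THE TWO REMAINING DISPLAYED INPUTS (PI) and (ShaFin)** (p680684 `hcounts_of_pointIndex_of_pinning_of_finiteSha` with (PIN)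
discharged by `hPIN_holds`). The conclusion is the hypothesis `hcounts` of -w5 g3 p678471 `hF3_of_levelCounts`, VERBATIM.
[cite: MilneADT2006, I §6 Lemma 6.15] [cite: Rubin1999, §2] [cite: Agboola2007, §6] -/
theorem hcounts_of_pointIndex_of_finiteSha
    (hPI : ∃ e₃ : ℤ → ℤ → ℤ, ∀ (d : ℤ), d ≠ 0 → Squarefree d → d % 4 ≠ 1 →
      ∀ (W : WeierstrassCurve ℚ) [W.IsElliptic] [W.IsGloballyMinimal] (C : WeierstrassCurve.VariableChange ℚ),
        C • W = cm7.quadraticTwist (d : ℚ) → W.analyticRank = 1 →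
      ∀ (K : Type) [Field K] [NumberField K], IsImaginaryQuadratic K →
      ∀ (v vbar : HeightOneSpectrum (𝓞 K)),
        ((2 : ℕ) : 𝓞 K) ∈ v.asIdeal → ((2 : ℕ) : 𝓞 K) ∈ vbar.asIdeal → vbar ≠ v →
      ∀ (π : (W.baseChange K).endRing), (π : AddMonoid.End (W.baseChange K).geomPoints) * π = π - 2 →
      ∀ (r : ℤ_[2]), r * r = r - 2 →
        (∀ τ ∈ GreenbergSelmer.inertia v, ∀ x : ↥((W.baseChange K).endEigenPrimaryTorsion 2 π r), τ • x = x ∨ τ • x = -x) →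
      ∀ (P : W.toAffine.Point) (c₀ : ℕ) (ℓ : ℤ),
        ¬ IsOfFinAddOrder P →
        (∀ R : W.toAffine.Point, ∃ (k : ℤ) (T : W.toAffine.Point), IsOfFinAddOrder T ∧ R = k • P + T) →
        c₀ ≠ 0 → (W.baseChange ℚ_[2]).IsInReductionKernel (c₀ • W.toPadicPoint 2 P) →
        ‖(W.baseChange ℚ_[2]).padicLogPoint (c₀ • W.toPadicPoint 2 P) / (c₀ : ℚ_[2])‖ = (2 : ℝ) ^ (-ℓ) →
      Finite (restrictedSelmerBase ↥((W.baseChange K).endEigenPrimaryTorsion 2 π r) 2 vbar) →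
      ∃ N₃ : ℕ, ∀ N : ℕ, N₃ ≤ N →
        (padicValNat 2 (((Affine.Point.baseChange (W' := W.baseChange K) K (v.adicCompletion K)).range ⊔
          (zsmulAddGroupHom ((2 ^ N : ℕ) : ℤ) : ((W.baseChange K).baseChange (v.adicCompletion K)).toAffine.Point →+ _).range).index) : ℤ) =
          ℓ + e₃ (d % 2) ((d / (2 - d % 2)) % 8))
    (hShaFin : ∀ (d : ℤ), d ≠ 0 → Squarefree d → d % 4 ≠ 1 →
      ∀ (W : WeierstrassCurve ℚ) [W.IsElliptic] [W.IsGloballyMinimal] (C : WeierstrassCurve.VariableChange ℚ),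
        C • W = cm7.quadraticTwist (d : ℚ) → W.analyticRank = 1 →
      ∀ (K : Type) [Field K] [NumberField K], IsImaginaryQuadratic K →
      ∀ (v vbar : HeightOneSpectrum (𝓞 K)),
        ((2 : ℕ) : 𝓞 K) ∈ v.asIdeal → ((2 : ℕ) : 𝓞 K) ∈ vbar.asIdeal → vbar ≠ v →
      ∀ (π : (W.baseChange K).endRing), (π : AddMonoid.End (W.baseChange K).geomPoints) * π = π - 2 →
      ∀ (r : ℤ_[2]), r * r = r - 2 →
        (∀ τ ∈ GreenbergSelmer.inertia v, ∀ x : ↥((W.baseChange K).endEigenPrimaryTorsion 2 π r), τ • x = x ∨ τ • x = -x) →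
      ∀ (P : W.toAffine.Point) (c₀ : ℕ) (ℓ : ℤ),
        ¬ IsOfFinAddOrder P →
        (∀ R : W.toAffine.Point, ∃ (k : ℤ) (T : W.toAffine.Point), IsOfFinAddOrder T ∧ R = k • P + T) →
        c₀ ≠ 0 → (W.baseChange ℚ_[2]).IsInReductionKernel (c₀ • W.toPadicPoint 2 P) →
        ‖(W.baseChange ℚ_[2]).padicLogPoint (c₀ • W.toPadicPoint 2 P) / (c₀ : ℚ_[2])‖ = (2 : ℝ) ^ (-ℓ) →
      Finite (restrictedSelmerBase ↥((W.baseChange K).endEigenPrimaryTorsion 2 π r) 2 vbar) →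
      Finite (AddCommGroup.primaryComponent (W.baseChange K).sha 2)) :
    ∃ e₃ : ℤ → ℤ → ℤ, ∀ (d : ℤ), d ≠ 0 → Squarefree d → d % 4 ≠ 1 →
      ∀ (W : WeierstrassCurve ℚ) [W.IsElliptic] [W.IsGloballyMinimal] (C : WeierstrassCurve.VariableChange ℚ),
        C • W = cm7.quadraticTwist (d : ℚ) → W.analyticRank = 1 →
      ∀ (K : Type) [Field K] [NumberField K], IsImaginaryQuadratic K →
      ∀ (v vbar : HeightOneSpectrum (𝓞 K)),
        ((2 : ℕ) : 𝓞 K) ∈ v.asIdeal → ((2 : ℕ) : 𝓞 K) ∈ vbar.asIdeal → vbar ≠ v →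
      ∀ (π : (W.baseChange K).endRing), (π : AddMonoid.End (W.baseChange K).geomPoints) * π = π - 2 →
      ∀ (r : ℤ_[2]), r * r = r - 2 →
        (∀ τ ∈ GreenbergSelmer.inertia v, ∀ x : ↥((W.baseChange K).endEigenPrimaryTorsion 2 π r), τ • x = x ∨ τ • x = -x) →
      ∀ (P : W.toAffine.Point) (c₀ : ℕ) (ℓ : ℤ),
        ¬ IsOfFinAddOrder P →
        (∀ R : W.toAffine.Point, ∃ (k : ℤ) (T : W.toAffine.Point), IsOfFinAddOrder T ∧ R = k • P + T) →
        c₀ ≠ 0 → (W.baseChange ℚ_[2]).IsInReductionKernel (c₀ • W.toPadicPoint 2 P) →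
        ‖(W.baseChange ℚ_[2]).padicLogPoint (c₀ • W.toPadicPoint 2 P) / (c₀ : ℚ_[2])‖ = (2 : ℝ) ^ (-ℓ) →
      Finite (restrictedSelmerBase ↥((W.baseChange K).endEigenPrimaryTorsion 2 π r) 2 vbar) →
      ∀ (e : (W.baseChange K).geomPrimaryTorsion 2 →+ ↥((W.baseChange K).endEigenPrimaryTorsion 2 π r)),
        (∀ x : ↥((W.baseChange K).endEigenPrimaryTorsion 2 π r), e x = x) →
        (∀ x ∈ (W.baseChange K).endEigenPrimaryTorsion 2 π (1 - r), e x = 0) →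
        (∀ (σ : absoluteGaloisGroup K) (x : (W.baseChange K).geomPrimaryTorsion 2), e (σ • x) = σ • e x) →
      ∃ N₁ : ℕ, ∀ N : ℕ, N₁ ≤ N →
        ∃ eN : ((W.baseChange K).torsionGaloisModule ((2 ^ N : ℕ) : ℤ)).toContRepresentation →ⁱL
            ((W.baseChange K).torsionGaloisModule ((2 ^ N : ℕ) : ℤ)).toContRepresentation,
          (∀ y, primaryInclusion (W.baseChange K) 2 N (eN y) =
            (e (primaryInclusion (W.baseChange K) 2 N y) : (W.baseChange K).geomPrimaryTorsion 2)) ∧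
          ∀ 𝓕 : SelmerStructure ((W.baseChange K).torsionGaloisModule ((2 ^ N : ℕ) : ℤ)),
            (∀ w : InfinitePlace K, 𝓕 (Sum.inl w) = ⊤) →
            (∀ w : HeightOneSpectrum (𝓞 K), w ≠ v →
              𝓕 (Sum.inr w) = (galoisCohomology.map ((primaryInclusion (W.baseChange K) 2 N).restrictField (w.adicCompletion K)) 1).ker) →
            𝓕 (Sum.inr v) = ((galoisCohomology.map ((primaryInclusion (W.baseChange K) 2 N).restrictField (v.adicCompletion K)) 1).ker).comap
              (galoisCohomology.map (eN.restrictField (v.adicCompletion K)) 1) →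
            (padicValNat 2 (𝓕.selmerGroup.relIndex (SelmerStructure.selmerGroup (Function.update 𝓕 (Sum.inr v : Place K) ⊤))) : ℤ) =
              ℓ + e₃ (d % 2) ((d / (2 - d % 2)) % 8) :=
  hcounts_of_pointIndex_of_pinning_of_finiteSha hPI hPIN_holds hShaFin

end Summit.BirchSwinnertonDyer.BirchSwinnertonDyer.Theorems.PrintCf2.SelmerLocImage

end
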